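import Literature.AlgebraicGeometry.Motives.HodgeStructureLefschetzGroupEigenspaceSplitting
import Literature.RingTheory.CentralSimple.BaseChangeSimple
import Mathlib.RingTheory.SimpleModule.IsAlgClosed
import HarnessLib

/-!
# Milne 1999 §2, type IV set-up on points: for `ι(F)` CENTRAL in `E_φ` every `a ∈ E_φ ⊗ K` preserves the blocks `V_{K,χ}`
# ("`E_σ = E ⊗_{F,σ} k^al` acts on `V_σ`"), and for `K` algebraically closed and `E_φ` central simple over `ι(F)` the image
# `K·(E_φ|V_{K,χ})` is a quotient of `K ⊗_{F,χ} E_φ ≃ M_d(K)`, `d²·[F:ℚ] = dim_ℚ E_φ` ("there exist isomorphisms `E_σ → Ē`",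
# `Ē = M_d(k^al) × M_d(k^al)`, one matrix factor per block) — the SPLITTINGS `ρ : M_d(K) →ₐ[K] End_K(V_{K,χ})` exist

[topic AlgebraicGeometry/Motives]

Layer `Literature/AlgebraicGeometry/Motives`, lane `lit-hodgefound` (Track 2 foundations library; seat `lit-hodgefound-p34`,
generation 22, self-proposed row g22-#3, FILE 1 of 2: the part of the type IV computation that needs neither the polarization
nor Morita theory, filed separately so that it imports BUILT modules only). Milne, type IV (p. 651): along
`F ⊗_ℚ k^al = ∏_σ k_σ` one has `E ⊗_ℚ k^al = ∏_σ E_σ`, `E_σ = E ⊗_{F,σ} k^al`, acting on `V_σ`; "using Remarks 2.2, 2.3, and 2.4,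
we find that, for each `σ`, there exist compatible isomorphisms `E_σ → Ē`, `(V_σ, φ_σ) → (V̄, φ̄)`" with
`Ē = M_d(k^al) × M_d(k^al)`. On the abstract polarized `ℚ`-Hodge structure with a number field `F` acting CENTRALLY
(`hcent : ι(F) ⊆ Z(E_φ)`; Milne's `F` here is the CM CENTRE `K` of `E`, and the two factors of `Ē` are the two blocks
`V_{K,χ}`, `V_{K,χ∘σ}` of a conjugate pair): §1 the restricted operators `a_K|V_{K,χ}` (`EndAction.blockOp`, typed in
`EndAction.BlockEnd K A χ = End_K(V_{K,χ})` on the `AddCommGroup` instance path used by `LinearAlgebra/Matrix/MatrixAlgebraModuleCorner`),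
§2 for `K` algebraically closed and `E_φ` simple with centre EXACTLY `ι(F)`: a unital `ρ : M_d(K) →ₐ[K] End_K(V_{K,χ})` with
image the `K`-span of the `a_K|V_{K,χ}` EXISTS, `d² · [F:ℚ] = dim_ℚ E_φ` (Milne's `d = [E:K]^{1/2}`) — `E_φ` is made an
`F`-algebra through `ι`, it is central (`Algebra.IsCentral`) by `hcen`, `K ⊗_{F,χ} E_φ` is simple
(`RingTheory/CentralSimple/BaseChangeSimple.isSimpleRing_tensorProduct`), hence `≃ₐ[K] M_d(K)` by Wedderburn–Artin over an
algebraically closed field (Mathlib `IsSimpleRing.exists_algEquiv_matrix_of_isAlgClosed`), and `ρ` is the action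
`c ⊗ a ↦ c · a_K|V_{K,χ}` (`Algebra.TensorProduct.lift`) precomposed with that isomorphism. Definitions WITH BODIES + theorems,
no named fact (net debt `0`). FILE 2 (`Motives/HodgeStructureLefschetzGroupCentralFieldSplitting`) does
`S(H)(K) ≃* ∏_{s ∈ Φ} Aut_{E_φ ⊗ K}(V_{K,τₛ}) ≃* ∏ GL(e V_{K,τₛ})` and, with this file, `≃* ∏ GL_{g/df}(K)` outright.

## The source, verbatim

J. S. Milne, *Lefschetz classes on abelian varieties*, Duke Math. J. **96** (1999) 639–675 [Milne1999LefschetzClasses]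
(held `paper:doi-10-1215-s0012-7094-99-09620-5`; Duke page = folio + 638), §2 p. 648 (p0010) and pp. 650–651 (p0012–p0013):
* (Remark 2.3, p. 648 L8–L22) "Consider the abstract situation: `k` is a field, `E` is a simple `k`-algebra with centre a field
  `K` of finite degree over `k`, and `V` is a left `E`-module. Then the centralizer `C(E)` of `E` in `End_k(V)` is equal to its
  centralizer in `End_K(V)`, and the canonical homomorphism `E ⊗_K C(E) → End_K(V)` is an isomorphism. […]
  `E ≈ M_r(Δ^opp) ⟹ C(E) ≈ M_t(Δ)`, `t = dim_K(V) / (r[Δ:K])`."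
* (type IV, p. 650 L63–L64) "In this case `E` is a division algebra whose centre is a CM-field `K`. We shall compute `C(A)` and
  `S(A)` over `k^al` only. Recall that `d = [E:K]^{1/2}` and that `fd | g`."
* (p. 651 L24–L56) "Corresponding to the decomposition `F ⊗_ℚ k^al = ∏_{σ:F→k^al} k_σ`, `k_σ = k^al`, of `F ⊗_ℚ k^al` into a
  product of fields, there are the decompositions `E ⊗_ℚ k^al = ∏_σ E_σ`, `E_σ = E ⊗_{F,σ} k^al`; `K ⊗_ℚ k^al = ∏_σ K_σ`,
  `K_σ = K ⊗_{F,σ} k^al`; `(V(A), φ) ⊗_k F ⊗_ℚ k^al = ⊕_σ (V_σ, φ_σ)`, `(V_σ, φ_σ) = (V(A), φ) ⊗_{F,σ} k^al`. Using Remarks 2.2,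
  2.3, and 2.4, we find that, for each `σ`, there exist compatible isomorphisms `E_σ → Ē`, `(V_σ, φ_σ) → (V̄, φ̄)`"
  (with, p. 651 L5–L6, "`Ē = M_d(k^al) × M_d(k^al)`").

## What is PROVED

* §1 `EndAction.baseChange_apply_mem_eigenspaceBaseChange_of_central` (**`a_K V_{K,χ} ⊆ V_{K,χ}`** for `a ∈ E_φ`, `ι(F)`
  central), ABBREV `EndAction.BlockEnd` (`End_K(V_{K,χ})`), DEF **`EndAction.blockOp`** (`a_K|V_{K,χ}`; `coe_blockOp_apply`),
  DEF `EndAction.blockRep` (retyping a user's `M_ι(K) →ₐ[K] Module.End K (V_{K,χ})` into `BlockEnd`, the identity; `blockRep_apply`).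
* §2 **`EndAction.exists_matrixAlgHom_span_blockOp_eq_range`**: `[IsAlgClosed K]`, `[IsSimpleRing E_φ]`, `hcent`,
  `hcen : Z(E_φ) ⊆ ι(F)` ⟹ for every `χ : F →ₐ[ℚ] K`,
  `∃ d, NeZero d ∧ d² · [F:ℚ] = dim_ℚ E_φ ∧ ∃ ρ : M_d(K) →ₐ[K] End_K(V_{K,χ}), K·{a_K|V_{K,χ}} = range ρ`.

NOT here (honest): splitting over a NON-closed `K` (Brauer group of `F`; one needs `K` to split `E_φ ⊗_{F,χ} K`); injectivity
`K ⊗_{F,χ} E_φ ↪ End_K(V_{K,χ})` (true when `V_{K,χ} ≠ 0` since the source is simple — not needed); the compatibility of the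
isomorphisms with `φ̄` and the involutions (Milne's `C(A)`); that a type IV `E_φ` IS central simple over a CM centre acting
through `ι` (Albert — hypotheses here). HC is NOT proved; nothing here claims a case of the Hodge conjecture.

## References

* [Milne1999LefschetzClasses] J. S. Milne, *Lefschetz classes on abelian varieties*, Duke Math. J. 96 (1999) 639–675 — §2
  Remark 2.3 (p. 648), pp. 650–651 (type IV).
* [Deligne1982HodgeCycles] P. Deligne, *Hodge cycles on abelian varieties*, LNM 900 (1982) — §4 (the decomposition
  `H¹_B ⊗ ℂ = ⊕_σ H¹_{B,σ}` along the action of a field, "e ∈ E acts on `H¹_{B,σ}` as `σe`").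
-/

noncomputable section

open scoped TensorProduct
open Function Module

namespace Literature.AlgebraicGeometry.Motives

namespace HodgeStructure

universe u uK

variable {V : Type u} [AddCommGroup V] [Module ℚ V] {n : ℤ} {H : HodgeStructure V n}
variable {F : Type*} [Field F] [NumberField F]
variable (K : Type uK) [Field K] [Algebra ℚ K] (A : EndAction H F)

/-! ## §1 `ι(F)` central in `E_φ`: every `a ∈ E_φ ⊗ K` preserves the blocks `V_{K,χ}`; the restricted operators -/

/-- **For `ι(F)` central in `E_φ`, `a_K V_{K,χ} ⊆ V_{K,χ}` for every `a ∈ E_φ`** ("`E ⊗_F K_σ` acts on `V_σ`").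
[cite: Milne1999LefschetzClasses, §2 p. 651 L36–L47 ("E ⊗_ℚ k^al = ∏_σ E_σ, E_σ = E ⊗_{F,σ} k^al … (V(A), φ) ⊗ = ⊕ (V_σ, φ_σ)")] -/
theorem EndAction.baseChange_apply_mem_eigenspaceBaseChange_of_central
    (hcent : ∀ a ∈ H.endAlg, ∀ f : F, a * A.ι f = A.ι f * a) {a : Module.End ℚ V} (ha : a ∈ H.endAlg)
    {χ : F →ₐ[ℚ] K} {x : K ⊗[ℚ] V} (hx : x ∈ A.eigenspaceBaseChange K χ) : a.baseChange K x ∈ A.eigenspaceBaseChange K χ :=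
  A.apply_mem_eigenspaceBaseChange_of_comm K (γ := a.baseChange K) (fun f y => by
    rw [← Module.End.mul_apply, ← LinearMap.baseChange_mul, hcent a ha f, LinearMap.baseChange_mul,
      Module.End.mul_apply]) hx

/-- **`End_K(V_{K,χ})` as a `K`-algebra on the additive GROUP `V_{K,χ}`** — the same type as `Module.End K (V_{K,χ})`, elaborated
through `AddCommGroup.toAddCommMonoid` (the instance path of `LinearAlgebra/Matrix/MatrixAlgebraModuleCorner`, whose carrier is an
`AddCommGroup`); the restricted operators `EndAction.blockOp` and the splittings `ρₛ : M_ι(K) →ₐ[K] End_K(V_{K,τₛ})` of §3–§4 live here (a `ρₛ` given on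
`Module.End K (V_{K,τₛ})` is retyped by `EndAction.blockRep`, definitionally the identity). [cite: Milne1999LefschetzClasses, §2 Remark 2.3 ("E ⊗_K C(E) → End_K(V) is an isomorphism")] -/
abbrev EndAction.BlockEnd (χ : F →ₐ[ℚ] K) : Type _ :=
  @Module.End K (A.eigenspaceBaseChange K χ) _ AddCommGroup.toAddCommMonoid inferInstance

/-- **The restricted operator `a_K|V_{K,χ}`** for `a ∈ E_φ`, `ι(F)` central. [cite: Milne1999LefschetzClasses, §2 p. 651 L36–L47] -/
def EndAction.blockOp (hcent : ∀ a ∈ H.endAlg, ∀ f : F, a * A.ι f = A.ι f * a) (χ : F →ₐ[ℚ] K) (a : H.endAlg) :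
    A.BlockEnd K χ :=
  ((a : Module.End ℚ V).baseChange K).restrict fun _ hx =>
    A.baseChange_apply_mem_eigenspaceBaseChange_of_central K hcent a.2 hx

/-- `(a_K|V_{K,χ}) x = a_K x`. [cite: Milne1999LefschetzClasses, §2 p. 651 L36–L47] -/
@[simp] theorem EndAction.coe_blockOp_apply (hcent : ∀ a ∈ H.endAlg, ∀ f : F, a * A.ι f = A.ι f * a) (χ : F →ₐ[ℚ] K)
    (a : H.endAlg) (x : A.eigenspaceBaseChange K χ) :
    ((A.blockOp K hcent χ a x : A.eigenspaceBaseChange K χ) : K ⊗[ℚ] V) = (a : Module.End ℚ V).baseChange K x :=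
  rfl

/-- Retyping a splitting `M_ι(K) →ₐ[K] Module.End K (V_{K,χ})` as `M_ι(K) →ₐ[K] EndAction.BlockEnd K A χ` (the identity).
[cite: Milne1999LefschetzClasses, §2 Remark 2.3] -/
def EndAction.blockRep {ι : Type*} [Fintype ι] [DecidableEq ι] (χ : F →ₐ[ℚ] K)
    (ρ : Matrix ι ι K →ₐ[K] Module.End K (A.eigenspaceBaseChange K χ)) : Matrix ι ι K →ₐ[K] A.BlockEnd K χ :=
  ρ

/-- `blockRep ρ M x = ρ M x`. [cite: Milne1999LefschetzClasses, §2 Remark 2.3] -/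
@[simp] theorem EndAction.blockRep_apply {ι : Type*} [Fintype ι] [DecidableEq ι] (χ : F →ₐ[ℚ] K)
    (ρ : Matrix ι ι K →ₐ[K] Module.End K (A.eigenspaceBaseChange K χ)) (M : Matrix ι ι K) (x : A.eigenspaceBaseChange K χ) :
    A.blockRep K χ ρ M x = ρ M x :=
  rfl

/-! ## §2 Existence of the splittings over an algebraically closed `K` (Wedderburn): for `E_φ` central simple over `ι(F)`,
`K ⊗_{F,χ} E_φ ≃ M_d(K)` maps onto `K·(E_φ|V_{K,χ})` — "there exist isomorphisms `E_σ → Ē = M_d(k^al) × M_d(k^al)`" -/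

/-- **The splitting exists over an algebraically closed field.** For `ι(F)` central in `E_φ`, `E_φ` simple with centre EXACTLY
`ι(F)` (`hcen`), and `K` algebraically closed: for every `χ : F → K` there are `d ≥ 1` with `d² · [F:ℚ] = dim_ℚ E_φ` (Milne's
`d = [E:K]^{1/2}`) and a unital `ρ : M_d(K) →ₐ[K] End_K(V_{K,χ})` whose image is the `K`-span of the restricted operators
`a_K|V_{K,χ}`, `a ∈ E_φ` — the action of `K ⊗_{F,χ} E_φ` on `V_{K,χ}` composed with a Wedderburn isomorphism
`M_d(K) ≃ K ⊗_{F,χ} E_φ` (`K ⊗_{F,χ} E_φ` is simple by `RingTheory/CentralSimple/BaseChangeSimple`, and a simple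
finite-dimensional algebra over an algebraically closed field is a matrix algebra, Mathlib's
`IsSimpleRing.exists_algEquiv_matrix_of_isAlgClosed`). This is the hypothesis `hρ` under which the lane's `Motives/HodgeStructureLefschetzGroupCentralFieldSplitting` §3
identifies `Aut_{E_φ ⊗ K}(V_{K,τₛ})` with `GL(e V_{K,τₛ})` (Remarks 2.3–2.4).
[cite: Milne1999LefschetzClasses, §2 p. 651 L49–L56 ("for each σ, there exist compatible isomorphisms E_σ → Ē") and p. 650 L64 ("d = [E:K]^{1/2}")] -/
theorem EndAction.exists_matrixAlgHom_span_blockOp_eq_range [IsAlgClosed K] [Module.Finite ℚ V]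
    (hcent : ∀ a ∈ H.endAlg, ∀ f : F, a * A.ι f = A.ι f * a) [IsSimpleRing H.endAlg]
    (hcen : ∀ z ∈ H.endAlg, (∀ a ∈ H.endAlg, a * z = z * a) → z ∈ Set.range A.ι) (χ : F →ₐ[ℚ] K) :
    ∃ d : ℕ, NeZero d ∧ d ^ 2 * finrank ℚ F = finrank ℚ H.endAlg ∧
      ∃ ρ : Matrix (Fin d) (Fin d) K →ₐ[K] A.BlockEnd K χ,
        Submodule.span K (Set.range (A.blockOp K hcent χ)) = LinearMap.range ρ.toLinearMap := by
  classical
  -- `K` as an `F`-algebra through `χ`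
  letI : Algebra F K := (χ : F →+* K).toAlgebra
  -- `E_φ` as an `F`-algebra through `ι` (possible since `ι(F)` is central), finite-dimensional, CENTRAL by `hcen`
  set E := H.endAlg with hEdef
  let fE : F →ₐ[ℚ] E := A.ι.codRestrict E A.map_F_le
  letI : Algebra F E := (fE : F →+* E).toAlgebra' fun f a => Subtype.ext (hcent a.1 a.2 f).symm
  have halg : ∀ f : F, ((algebraMap F E f : E) : Module.End ℚ V) = A.ι f := fun _ => rfl
  haveI : IsScalarTower ℚ F E := IsScalarTower.of_algebraMap_eq fun q => Subtype.ext (by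
    rw [halg, AlgHom.commutes]; rfl)
  haveI : Module.Finite F E := Module.Finite.of_restrictScalars_finite ℚ F E
  haveI : Algebra.IsCentral F E := ⟨fun z hz => by
    rw [Subalgebra.mem_center_iff] at hz
    obtain ⟨f, hf⟩ := hcen z.1 z.2 fun a ha => congrArg Subtype.val (hz ⟨a, ha⟩)
    exact Algebra.mem_bot.2 ⟨f, Subtype.ext hf⟩⟩
  -- Wedderburn over the algebraically closed `K`: `K ⊗_{F,χ} E_φ ≃ M_d(K)`, `d² = [E_φ : F]`
  haveI : IsSimpleRing (K ⊗[F] E) := Literature.RingTheory.CentralSimple.isSimpleRing_tensorProduct K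
  obtain ⟨d, hd, ⟨e⟩⟩ := IsSimpleRing.exists_algEquiv_matrix_of_isAlgClosed K (K ⊗[F] E)
  have hdim : d ^ 2 * finrank ℚ F = finrank ℚ E := by
    have h1 : finrank K (K ⊗[F] E) = finrank F E := Module.finrank_baseChange
    have h2 : finrank K (K ⊗[F] E) = d * d := by
      rw [e.toLinearEquiv.finrank_eq, Module.finrank_matrix, Fintype.card_fin, Module.finrank_self, mul_one]
    rw [← Module.finrank_mul_finrank ℚ F E, ← h1, h2, sq, mul_comm]
  -- the action `Θ : K ⊗_{F,χ} E_φ → End_K(V_{K,χ})`, `c ⊗ a ↦ c · a_K|V_{K,χ}` (`ι(f)` acts on `V_{K,χ}` by `χ(f)`)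
  letI : Algebra F (A.BlockEnd K χ) :=
    ((algebraMap K (A.BlockEnd K χ)).comp (χ : F →+* K)).toAlgebra' fun f x => Algebra.commutes (χ f) x
  have hFB : ∀ f : F, algebraMap F (A.BlockEnd K χ) f = algebraMap K (A.BlockEnd K χ) (χ f) := fun _ => rfl
  haveI := IsScalarTower.of_algebraMap_eq (R := F) (S := K) (A := A.BlockEnd K χ) fun _ => rfl
  let g : E →ₐ[F] A.BlockEnd K χ :=
    { toFun := fun a => A.blockOp K hcent χ a
      map_one' := LinearMap.ext fun x => Subtype.ext (by
        rw [EndAction.coe_blockOp_apply]; simp)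
      map_mul' := fun a b => LinearMap.ext fun x => Subtype.ext (by
        rw [EndAction.coe_blockOp_apply, Module.End.mul_apply, EndAction.coe_blockOp_apply,
          EndAction.coe_blockOp_apply, Subalgebra.coe_mul, LinearMap.baseChange_mul, Module.End.mul_apply])
      map_zero' := LinearMap.ext fun x => Subtype.ext (by
        rw [EndAction.coe_blockOp_apply]; simp)
      map_add' := fun a b => LinearMap.ext fun x => Subtype.ext (by
        rw [EndAction.coe_blockOp_apply, LinearMap.add_apply, Submodule.coe_add, EndAction.coe_blockOp_apply,
          EndAction.coe_blockOp_apply, Subalgebra.coe_add, LinearMap.baseChange_add, LinearMap.add_apply])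
      commutes' := fun f => LinearMap.ext fun x => Subtype.ext (by
        rw [EndAction.coe_blockOp_apply, halg, hFB, Module.algebraMap_end_apply, Submodule.coe_smul,
          A.baseChange_ι_apply_of_mem_eigenspaceBaseChange K x.2 f]) }
  have hg : ∀ a : E, g a = A.blockOp K hcent χ a := fun _ => rfl
  let Θ : K ⊗[F] E →ₐ[K] A.BlockEnd K χ :=
    Algebra.TensorProduct.lift (Algebra.ofId K (A.BlockEnd K χ)) g fun c a => Algebra.commutes c (g a)
  have hΘ : ∀ (c : K) (a : E), Θ (c ⊗ₜ a) = c • A.blockOp K hcent χ a := fun c a => by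
    simp only [Θ, Algebra.TensorProduct.lift_tmul, Algebra.ofId_apply, hg]
    refine LinearMap.ext fun x => ?_
    rw [Module.End.mul_apply, Module.algebraMap_end_apply, LinearMap.smul_apply]
  refine ⟨d, hd, hdim, Θ.comp (e.symm : Matrix (Fin d) (Fin d) K →ₐ[K] K ⊗[F] E), ?_⟩
  -- `range (Θ ∘ e⁻¹) = range Θ = K · {a_K|V_{K,χ}}`
  rw [AlgHom.comp_toLinearMap, LinearMap.range_comp_of_range_eq_top _
    (LinearMap.range_eq_top.2 e.symm.surjective)]
  refine le_antisymm (Submodule.span_le.2 ?_) ?_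
  · rintro _ ⟨a, rfl⟩
    exact ⟨(1 : K) ⊗ₜ a, by rw [AlgHom.toLinearMap_apply, hΘ, one_smul]⟩
  · rintro y ⟨x, rfl⟩
    induction x using TensorProduct.induction_on with
    | zero => rw [map_zero]; exact Submodule.zero_mem _
    | tmul c a =>
      rw [AlgHom.toLinearMap_apply, hΘ]
      exact Submodule.smul_mem _ c (Submodule.subset_span ⟨a, rfl⟩)
    | add x y hx hy => rw [map_add]; exact Submodule.add_mem _ hx hy

end HodgeStructure

end Literature.AlgebraicGeometry.Motives
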